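import Mathlib
import HarnessLib

/-!
# `NoHeavyLowerTail` (crux stmt-CriticalPhenomena-4575), antithetic vdBHK programme: the PRODUCT LEMMA for the rearrangement inequality (R) —
# (R)(X,L) ∧ AK(Y) ⟹ (R)(X × Y, L × Y)   (THEOREM R₀ of FINDING-FLOW-g50 §4h)

Support file (seat `prim-ineq-gen-7` gen 51; `--supports stmt-CriticalPhenomena-4575`).  No `sorry`, no definitions.  Memo: FINDING-FENCE-g51.md §6.

SETTING (as in `AntitheticWedgeTransfer`).  `X`, `Y` finite partial orders with self-maps `ιX` (an involution), `ιY`, `L ⊆ X`; (R) for `(X,L)`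
in quadruple form (`hR`, verbatim the hypothesis of `wedge_transfer`); `Y` antipodal Kleitman in up-set form (`hAKY`).  On `X × Y` (product order,
involution `(x,y) ↦ (ιX x, ιY y)`, subset `{p : p.1 ∈ L}`) the T-pattern and (R) are the same formulas.
* slicing lemmas: `mem_slice`, `card_eq_sum_slice` (rows `y = const`), `mem_col`, `card_eq_sum_col` (columns `x = const`).
* `twist_le` — the AK(Y) step: `#(A ∩ ι B) ≤ #{p ∈ A : (ιX p.1, p.2) ∈ B}` for up-sets `A, B` of `X × Y` (apply AK(Y) in every column).
* `product_R` — **THEOREM R₀**: (R) for `(X × Y, L × Y)`.  PROOF (g50): the AK(Y) step replaces `ι` by `ιX × id` in the two negative terms; then every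
  row `y = const` is a T-pattern pair of `(X,L)` and (R)(X,L) applies row by row; the positive terms slice exactly.
CONSEQUENCES (g50 §4h): (R) for all Boolean lattices over a point base (`Q` an antichain), and for `Ω_{Q ⊔ Q'}` at an atom of `Q` whenever it holds for
`Ω_Q` there and `Ω_{Q'}` is AK; with `wedge_transfer`, AK of the corresponding wedge gluings.
-/

namespace Summit.CriticalPhenomena.PercolationContinuityZ3.Theorems

open Finset

namespace AntitheticWedgeProduct

variable {X Y : Type*} [PartialOrder X] [PartialOrder Y] [DecidableEq X] [DecidableEq Y] [Fintype X] [Fintype Y]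

omit [PartialOrder X] [PartialOrder Y] [Fintype X] [Fintype Y] in
/-- Membership in the row slice `{x : (x,y) ∈ S}`. -/
theorem mem_slice (S : Finset (X × Y)) (y : Y) (x : X) :
    x ∈ (S.filter (fun p => p.2 = y)).image Prod.fst ↔ (x, y) ∈ S := by
  simp only [Finset.mem_image, Finset.mem_filter]
  constructor
  · rintro ⟨⟨x', y'⟩, ⟨hS, hy⟩, hx⟩
    simp only at hx hy
    subst hx; subst hy; exact hS
  · intro h
    exact ⟨(x, y), ⟨h, rfl⟩, rfl⟩

omit [PartialOrder X] [PartialOrder Y] [Fintype X] [Fintype Y] in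
/-- Membership in the column slice `{y : (x,y) ∈ S}`. -/
theorem mem_col (S : Finset (X × Y)) (x : X) (y : Y) :
    y ∈ (S.filter (fun p => p.1 = x)).image Prod.snd ↔ (x, y) ∈ S := by
  simp only [Finset.mem_image, Finset.mem_filter]
  constructor
  · rintro ⟨⟨x', y'⟩, ⟨hS, hx⟩, hy⟩
    simp only at hx hy
    subst hx; subst hy; exact hS
  · intro h
    exact ⟨(x, y), ⟨h, rfl⟩, rfl⟩

omit [PartialOrder X] [PartialOrder Y] [Fintype X] in
/-- A finite subset of `X × Y` is counted by its row slices. -/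
theorem card_eq_sum_slice (S : Finset (X × Y)) :
    S.card = ∑ y : Y, ((S.filter (fun p => p.2 = y)).image Prod.fst).card := by
  rw [Finset.card_eq_sum_card_fiberwise (f := Prod.snd) (s := S) (t := (Finset.univ : Finset Y))
    (fun p _ => Finset.mem_coe.2 (Finset.mem_univ _))]
  refine Finset.sum_congr rfl fun y _ => ?_
  rw [Finset.card_image_of_injOn]
  intro p hp q hq h
  have hp' := (Finset.mem_filter.1 (Finset.mem_coe.1 hp)).2
  have hq' := (Finset.mem_filter.1 (Finset.mem_coe.1 hq)).2
  exact Prod.ext h (hp'.trans hq'.symm)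

omit [PartialOrder X] [PartialOrder Y] [Fintype Y] in
/-- A finite subset of `X × Y` is counted by its column slices. -/
theorem card_eq_sum_col (S : Finset (X × Y)) :
    S.card = ∑ x : X, ((S.filter (fun p => p.1 = x)).image Prod.snd).card := by
  rw [Finset.card_eq_sum_card_fiberwise (f := Prod.fst) (s := S) (t := (Finset.univ : Finset X))
    (fun p _ => Finset.mem_coe.2 (Finset.mem_univ _))]
  refine Finset.sum_congr rfl fun x _ => ?_
  rw [Finset.card_image_of_injOn]
  intro p hp q hq h
  have hp' := (Finset.mem_filter.1 (Finset.mem_coe.1 hp)).2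
  have hq' := (Finset.mem_filter.1 (Finset.mem_coe.1 hq)).2
  exact Prod.ext (hp'.trans hq'.symm) h

omit [Fintype Y] in
/-- **The AK(Y) step.**  For up-sets `A, B` of `X × Y`, the map `(x,y) ↦ (ιX x, ιY y)` and `Y` AK in up-set form w.r.t. `ιY`:
`#(A ∩ ι B) ≤ #{p ∈ A : (ιX p.1, p.2) ∈ B}` (`ιX` involutive, `ιY` any self-map) — in every column `x = const`, AK(Y) trades `ιY` for the identity. [this work] -/
theorem twist_le (ιX : X → X) (ιY : Y → Y) (hιX : Function.Involutive ιX)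
    (hAKY : ∀ V W : Finset Y, (∀ x y, x ≤ y → x ∈ V → y ∈ V) → (∀ x y, x ≤ y → x ∈ W → y ∈ W) →
      (V ∩ W.image ιY).card ≤ (V ∩ W).card)
    (A B : Finset (X × Y)) (hA : ∀ p q, p ≤ q → p ∈ A → q ∈ A) (hB : ∀ p q, p ≤ q → p ∈ B → q ∈ B) :
    (A ∩ B.image (fun p => (ιX p.1, ιY p.2))).card ≤ (A.filter (fun p => (ιX p.1, p.2) ∈ B)).card := by
  classical
  rw [card_eq_sum_col (A ∩ B.image (fun p => (ιX p.1, ιY p.2))), card_eq_sum_col (A.filter (fun p => (ιX p.1, p.2) ∈ B))]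
  refine Finset.sum_le_sum fun x _ => ?_
  -- column of A at x, column of B at ιX x
  set V : Finset Y := (A.filter (fun p => p.1 = x)).image Prod.snd with hV
  set W : Finset Y := (B.filter (fun p => p.1 = ιX x)).image Prod.snd with hW
  have hVup : ∀ y y', y ≤ y' → y ∈ V → y' ∈ V := by
    intro y y' hyy hy
    rw [hV, mem_col] at hy ⊢
    exact hA (x, y) (x, y') ⟨le_rfl, hyy⟩ hy
  have hWup : ∀ y y', y ≤ y' → y ∈ W → y' ∈ W := by
    intro y y' hyy hy
    rw [hW, mem_col] at hy ⊢
    exact hB (ιX x, y) (ιX x, y') ⟨le_rfl, hyy⟩ hy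
  have h1 : ((A ∩ B.image (fun p => (ιX p.1, ιY p.2))).filter (fun p => p.1 = x)).image Prod.snd = V ∩ W.image ιY := by
    ext y
    rw [mem_col, Finset.mem_inter, Finset.mem_inter, hV, hW, mem_col, Finset.mem_image, Finset.mem_image]
    constructor
    · rintro ⟨ha, ⟨⟨x', y'⟩, hb, hxy⟩⟩
      simp only [Prod.mk.injEq] at hxy
      obtain ⟨hx', hy'⟩ := hxy
      refine ⟨ha, ⟨y', ?_, hy'⟩⟩
      have hx'' : ιX x = x' := by rw [← hx', hιX x']
      rw [mem_col, hx'']; exact hb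
    · rintro ⟨ha, ⟨y', hy'W, hy'⟩⟩
      rw [mem_col] at hy'W
      exact ⟨ha, ⟨(ιX x, y'), hy'W, by simp [hy', hιX x]⟩⟩
  have h2 : ((A.filter (fun p => (ιX p.1, p.2) ∈ B)).filter (fun p => p.1 = x)).image Prod.snd = V ∩ W := by
    ext y
    rw [mem_col, Finset.mem_inter, Finset.mem_filter, hV, hW, mem_col, mem_col]
  rw [h1, h2]
  exact hAKY V W hVup hWup

/-- **THEOREM R₀ (product lemma for (R)).**  `(R)(X,L)` (quadruple form, `hR`; `ιX` involutive) and `Y` AK in up-set form w.r.t. a self-map `ιY` (`hAKY`) imply `(R)` for the product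
`X × Y` with involution `(ιX × ιY)` and subset `{p : p.1 ∈ L}`: for every pair of T-pattern quadruples of up-sets of `X × Y`,
`#(A₂ ∩ ιB₃) + #(A₃ ∩ ιB₂) ≤ #(A₂ ∩ B₂) + #(A₃ ∩ B₃) + #((A₄ ∖ A₁) ∩ (B₄ ∖ B₁))`. [FINDING-FLOW-g50 §4h, THEOREM R₀; this work] -/
theorem product_R (ιX : X → X) (ιY : Y → Y) (hιX : Function.Involutive ιX) (L : Finset X)
    (hR : ∀ A₁ A₂ A₃ A₄ B₁ B₂ B₃ B₄ : Finset X,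
      (∀ x y, x ≤ y → x ∈ A₁ → y ∈ A₁) → (∀ x y, x ≤ y → x ∈ A₂ → y ∈ A₂) →
      (∀ x y, x ≤ y → x ∈ A₃ → y ∈ A₃) → (∀ x y, x ≤ y → x ∈ A₄ → y ∈ A₄) →
      (∀ x y, x ≤ y → x ∈ B₁ → y ∈ B₁) → (∀ x y, x ≤ y → x ∈ B₂ → y ∈ B₂) →
      (∀ x y, x ≤ y → x ∈ B₃ → y ∈ B₃) → (∀ x y, x ≤ y → x ∈ B₄ → y ∈ B₄) →
      A₁ ⊆ A₃ → A₂ ⊆ A₄ → (∀ x, x ∈ L → x ∈ A₃ → x ∈ A₄) → (∀ x, x ∉ L → x ∈ A₁ → x ∈ A₂) →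
      (∀ x y, x ≤ y → x ∈ L → y ∉ L → x ∈ A₃ → y ∈ A₄) → (∀ x y, x ≤ y → x ∈ L → y ∉ L → x ∈ A₂ → y ∈ A₃) →
      B₁ ⊆ B₃ → B₂ ⊆ B₄ → (∀ x, x ∈ L → x ∈ B₃ → x ∈ B₄) → (∀ x, x ∉ L → x ∈ B₁ → x ∈ B₂) →
      (∀ x y, x ≤ y → x ∈ L → y ∉ L → x ∈ B₃ → y ∈ B₄) → (∀ x y, x ≤ y → x ∈ L → y ∉ L → x ∈ B₂ → y ∈ B₃) →
      (A₂ ∩ B₃.image ιX).card + (A₃ ∩ B₂.image ιX).card ≤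
        (A₂ ∩ B₂).card + (A₃ ∩ B₃).card + ((A₄ \ A₁) ∩ (B₄ \ B₁)).card)
    (hAKY : ∀ V W : Finset Y, (∀ x y, x ≤ y → x ∈ V → y ∈ V) → (∀ x y, x ≤ y → x ∈ W → y ∈ W) →
      (V ∩ W.image ιY).card ≤ (V ∩ W).card)
    (A₁ A₂ A₃ A₄ B₁ B₂ B₃ B₄ : Finset (X × Y))
    (hA₁ : ∀ p q, p ≤ q → p ∈ A₁ → q ∈ A₁) (hA₂ : ∀ p q, p ≤ q → p ∈ A₂ → q ∈ A₂)
    (hA₃ : ∀ p q, p ≤ q → p ∈ A₃ → q ∈ A₃) (hA₄ : ∀ p q, p ≤ q → p ∈ A₄ → q ∈ A₄)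
    (hB₁ : ∀ p q, p ≤ q → p ∈ B₁ → q ∈ B₁) (hB₂ : ∀ p q, p ≤ q → p ∈ B₂ → q ∈ B₂)
    (hB₃ : ∀ p q, p ≤ q → p ∈ B₃ → q ∈ B₃) (hB₄ : ∀ p q, p ≤ q → p ∈ B₄ → q ∈ B₄)
    (a13 : A₁ ⊆ A₃) (a24 : A₂ ⊆ A₄) (a34 : ∀ p, p.1 ∈ L → p ∈ A₃ → p ∈ A₄) (a12 : ∀ p, p.1 ∉ L → p ∈ A₁ → p ∈ A₂)
    (aC34 : ∀ p q, p ≤ q → p.1 ∈ L → q.1 ∉ L → p ∈ A₃ → q ∈ A₄) (aC23 : ∀ p q, p ≤ q → p.1 ∈ L → q.1 ∉ L → p ∈ A₂ → q ∈ A₃)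
    (b13 : B₁ ⊆ B₃) (b24 : B₂ ⊆ B₄) (b34 : ∀ p, p.1 ∈ L → p ∈ B₃ → p ∈ B₄) (b12 : ∀ p, p.1 ∉ L → p ∈ B₁ → p ∈ B₂)
    (bC34 : ∀ p q, p ≤ q → p.1 ∈ L → q.1 ∉ L → p ∈ B₃ → q ∈ B₄) (bC23 : ∀ p q, p ≤ q → p.1 ∈ L → q.1 ∉ L → p ∈ B₂ → q ∈ B₃) :
    (A₂ ∩ B₃.image (fun p => (ιX p.1, ιY p.2))).card + (A₃ ∩ B₂.image (fun p => (ιX p.1, ιY p.2))).card ≤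
      (A₂ ∩ B₂).card + (A₃ ∩ B₃).card + ((A₄ \ A₁) ∩ (B₄ \ B₁)).card := by
  classical
  -- Step 1: the AK(Y) step in both negative terms
  have t1 := twist_le ιX ιY hιX hAKY A₂ B₃ hA₂ hB₃
  have t2 := twist_le ιX ιY hιX hAKY A₃ B₂ hA₃ hB₂
  -- Step 2: slice everything by rows and apply (R)(X,L) in each row
  have key : (A₂.filter (fun p => (ιX p.1, p.2) ∈ B₃)).card + (A₃.filter (fun p => (ιX p.1, p.2) ∈ B₂)).card ≤
      (A₂ ∩ B₂).card + (A₃ ∩ B₃).card + ((A₄ \ A₁) ∩ (B₄ \ B₁)).card := by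
    rw [card_eq_sum_slice (A₂.filter (fun p => (ιX p.1, p.2) ∈ B₃)), card_eq_sum_slice (A₃.filter (fun p => (ιX p.1, p.2) ∈ B₂)),
      card_eq_sum_slice (A₂ ∩ B₂), card_eq_sum_slice (A₃ ∩ B₃), card_eq_sum_slice ((A₄ \ A₁) ∩ (B₄ \ B₁)),
      ← Finset.sum_add_distrib, ← Finset.sum_add_distrib, ← Finset.sum_add_distrib]
    refine Finset.sum_le_sum fun y _ => ?_
    -- the row slices
    set a₁ : Finset X := (A₁.filter (fun p => p.2 = y)).image Prod.fst with ha₁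
    set a₂ : Finset X := (A₂.filter (fun p => p.2 = y)).image Prod.fst with ha₂
    set a₃ : Finset X := (A₃.filter (fun p => p.2 = y)).image Prod.fst with ha₃
    set a₄ : Finset X := (A₄.filter (fun p => p.2 = y)).image Prod.fst with ha₄
    set b₁ : Finset X := (B₁.filter (fun p => p.2 = y)).image Prod.fst with hb₁
    set b₂ : Finset X := (B₂.filter (fun p => p.2 = y)).image Prod.fst with hb₂
    set b₃ : Finset X := (B₃.filter (fun p => p.2 = y)).image Prod.fst with hb₃
    set b₄ : Finset X := (B₄.filter (fun p => p.2 = y)).image Prod.fst with hb₄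
    -- up-set and pattern properties of the slices
    have up_of : ∀ (S : Finset (X × Y)), (∀ p q, p ≤ q → p ∈ S → q ∈ S) →
        ∀ x x' : X, x ≤ x' → x ∈ (S.filter (fun p => p.2 = y)).image Prod.fst → x' ∈ (S.filter (fun p => p.2 = y)).image Prod.fst := by
      intro S hS x x' hxx hx
      rw [mem_slice] at hx ⊢
      exact hS (x, y) (x', y) ⟨hxx, le_rfl⟩ hx
    have sub_of : ∀ (S T : Finset (X × Y)), S ⊆ T →
        (S.filter (fun p => p.2 = y)).image Prod.fst ⊆ (T.filter (fun p => p.2 = y)).image Prod.fst := by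
      intro S T hST x hx
      rw [mem_slice] at hx ⊢
      exact hST hx
    have subL_of : ∀ (S T : Finset (X × Y)), (∀ p, p.1 ∈ L → p ∈ S → p ∈ T) →
        ∀ x, x ∈ L → x ∈ (S.filter (fun p => p.2 = y)).image Prod.fst → x ∈ (T.filter (fun p => p.2 = y)).image Prod.fst := by
      intro S T hST x hxL hx
      rw [mem_slice] at hx ⊢
      exact hST (x, y) hxL hx
    have subP_of : ∀ (S T : Finset (X × Y)), (∀ p, p.1 ∉ L → p ∈ S → p ∈ T) →
        ∀ x, x ∉ L → x ∈ (S.filter (fun p => p.2 = y)).image Prod.fst → x ∈ (T.filter (fun p => p.2 = y)).image Prod.fst := by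
      intro S T hST x hxL hx
      rw [mem_slice] at hx ⊢
      exact hST (x, y) hxL hx
    have cross_of : ∀ (S T : Finset (X × Y)), (∀ p q, p ≤ q → p.1 ∈ L → q.1 ∉ L → p ∈ S → q ∈ T) →
        ∀ x x' : X, x ≤ x' → x ∈ L → x' ∉ L → x ∈ (S.filter (fun p => p.2 = y)).image Prod.fst →
          x' ∈ (T.filter (fun p => p.2 = y)).image Prod.fst := by
      intro S T hST x x' hxx hxL hx'L hx
      rw [mem_slice] at hx ⊢
      exact hST (x, y) (x', y) ⟨hxx, le_rfl⟩ hxL hx'L hx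
    have r := hR a₁ a₂ a₃ a₄ b₁ b₂ b₃ b₄ (up_of A₁ hA₁) (up_of A₂ hA₂) (up_of A₃ hA₃) (up_of A₄ hA₄)
      (up_of B₁ hB₁) (up_of B₂ hB₂) (up_of B₃ hB₃) (up_of B₄ hB₄)
      (sub_of A₁ A₃ a13) (sub_of A₂ A₄ a24) (subL_of A₃ A₄ a34) (subP_of A₁ A₂ a12) (cross_of A₃ A₄ aC34) (cross_of A₂ A₃ aC23)
      (sub_of B₁ B₃ b13) (sub_of B₂ B₄ b24) (subL_of B₃ B₄ b34) (subP_of B₁ B₂ b12) (cross_of B₃ B₄ bC34) (cross_of B₂ B₃ bC23)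
    -- identify the row slices of the five product-level sets
    have e1 : ((A₂.filter (fun p => (ιX p.1, p.2) ∈ B₃)).filter (fun p => p.2 = y)).image Prod.fst = a₂ ∩ b₃.image ιX := by
      ext x
      rw [mem_slice, Finset.mem_filter, Finset.mem_inter, ha₂, hb₃, mem_slice, Finset.mem_image]
      constructor
      · rintro ⟨h1, h2⟩
        exact ⟨h1, ⟨ιX x, by rw [mem_slice]; exact h2, hιX x⟩⟩
      · rintro ⟨h1, ⟨x', hx', hxx⟩⟩
        rw [mem_slice] at hx'
        refine ⟨h1, ?_⟩
        have : ιX x = x' := by rw [← hxx, hιX x']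
        rw [this]; exact hx'
    have e2 : ((A₃.filter (fun p => (ιX p.1, p.2) ∈ B₂)).filter (fun p => p.2 = y)).image Prod.fst = a₃ ∩ b₂.image ιX := by
      ext x
      rw [mem_slice, Finset.mem_filter, Finset.mem_inter, ha₃, hb₂, mem_slice, Finset.mem_image]
      constructor
      · rintro ⟨h1, h2⟩
        exact ⟨h1, ⟨ιX x, by rw [mem_slice]; exact h2, hιX x⟩⟩
      · rintro ⟨h1, ⟨x', hx', hxx⟩⟩
        rw [mem_slice] at hx'
        refine ⟨h1, ?_⟩
        have : ιX x = x' := by rw [← hxx, hιX x']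
        rw [this]; exact hx'
    have e3 : ((A₂ ∩ B₂).filter (fun p => p.2 = y)).image Prod.fst = a₂ ∩ b₂ := by
      ext x
      rw [mem_slice, Finset.mem_inter, Finset.mem_inter, ha₂, hb₂, mem_slice, mem_slice]
    have e4 : ((A₃ ∩ B₃).filter (fun p => p.2 = y)).image Prod.fst = a₃ ∩ b₃ := by
      ext x
      rw [mem_slice, Finset.mem_inter, Finset.mem_inter, ha₃, hb₃, mem_slice, mem_slice]
    have e5 : (((A₄ \ A₁) ∩ (B₄ \ B₁)).filter (fun p => p.2 = y)).image Prod.fst = (a₄ \ a₁) ∩ (b₄ \ b₁) := by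
      ext x
      rw [mem_slice, Finset.mem_inter, Finset.mem_inter, Finset.mem_sdiff, Finset.mem_sdiff, Finset.mem_sdiff, Finset.mem_sdiff,
        ha₄, ha₁, hb₄, hb₁, mem_slice, mem_slice, mem_slice, mem_slice]
    rw [e1, e2, e3, e4, e5]
    exact r
  omega

end AntitheticWedgeProduct

end Summit.CriticalPhenomena.PercolationContinuityZ3.Theorems
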